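import Literature.MathematicalPhysics.QuantumLattice.PairFieldMomentum
import HarnessLib

/-!
# Block Plancherel for pair operators: block pair coherence is a Fejér-weighted sum of the pair
# structure factor, so a FLAT structure factor carries no block (mesoscopic) pair order

Topic `MathematicalPhysics/QuantumLattice`, family `hubbard`; proof-only companion of
`PairFieldMomentum.lean` (momentum-resolved pair field `Δ_g(m) = pairFieldAt g L m = Σ_x conj χ_m(x) P_x`,
operator Plancherel `sum_conjTranspose_mul_fourierMode`). For the local singlet pairs
`P_x = localPair g L x` on the fermionic torus `(ℤ/Lℤ)²` and the BOX PAIR OPERATORS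
`B_a = Σ_{u ∈ [0,R)²} P_{a+u}` (written literally, `a + (i ↦ ((u i : ℕ) : ZMod L))`, exactly as in the
Summits-side tent identity `Σ_a ‖B_a ψ‖² = R² · T_R(ψ)` of route `FunctionFieldCertificate`):

* `boxOffset_injective`, `sum_conj_boxKernel_mul_boxKernel` — the box kernel
  `F_R(m) = Σ_{u ∈ [0,R)²} χ_m(u)` satisfies `Σ_m conj F_R(m) · F_R(m) = L² R²` for `R ≤ L`
  (orthogonality of characters; the `R²` offsets are distinct torus points);
* `fourierMode_block` — the Fourier mode of the block family is the box kernel times the pair mode,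
  `Σ_a conj χ_m(a) • B_a = F_R(m) • Δ_g(m)`;
* `sum_conjTranspose_block_mul_block` — **block Plancherel**:
  `L² • Σ_a B_aᴴ B_a = Σ_m (conj F_R(m) F_R(m)) • Δ_g(m)ᴴ Δ_g(m)`, i.e. `Σ_a ‖B_a ψ‖² =
  L⁻² Σ_m |F_R(m)|² ‖Δ_g(m) ψ‖²` — block pair coherence is the pair structure factor
  `S_ψ(m) = ‖Δ_g(m)ψ‖²/L²` summed against the (nonnegative, mass `L²R²`) Fejér weights `|F_R(m)|²`;
* `re_trace_mul_sum_block_le_of_forall_mode_le`, `re_sum_star_block_mulVec_le_of_forall_mode_le` —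
  **a flat pair structure factor carries no block pair order**: if `Re tr (P Δ_g(m)ᴴ Δ_g(m)) ≤ S`
  for EVERY `m` (any matrix `P`; e.g. a density matrix, or a vector state: `‖Δ_g(m) ψ‖² ≤ S`), then
  `Re tr (P Σ_a B_aᴴ B_a) ≤ S · R²` (resp. `Σ_a ‖B_a ψ‖² ≤ S · R²`) for every block size `R ≤ L`.
  With the tent identity this reads `T_R(ψ) ≤ L² · sup_m S_ψ(m)`: the Fejér-box pair functional of
  route `FunctionFieldCertificate`'s crux `MesoscopicPairOrder` (which asks `T_R(ψ) ≥ m R² L²` in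
  every sector ground state) detects, at scale `R`, exactly a pair mode with `S_ψ(m) ≥ m R²`; a state
  whose pair structure factor is bounded uniformly in `L` (the free Fermi gas: `S ≤ 50`,
  Summits-side `WindowGap.Negative.re_trace_mul_conjTranspose_pairFieldAt_dWave_mul_le`; any
  "normal" state) has mesoscopic pair-order margin `≤ sup S / R²`, with no logarithm.

Sources: T. Kennedy, E. H. Lieb, B. S. Shastry, PRL 61 (1988) 2582 (Fourier modes of an order
operator and the Parseval sum rule); E. M. Stein, R. Shakarchi, *Fourier Analysis* (2003), Ch. 2
(the Fejér kernel is the autocorrelation of a box); S. Friedli, Y. Velenik, *Statistical Mechanics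
of Lattice Systems* (2017), §10.4 (Fourier analysis on `(ℤ/Lℤ)^d`). Folklore finite-dimensional
statements; no named facts, no definitions.

## Mathlib / tree search

Tree (`lean search`): `sum_conjTranspose_mul_fourierMode`, `pairFieldAt_eq_sum_torusChar`,
`star_mulVec_dotProduct_mulVec` (`PairFieldMomentum`); `sum_torusChar_left`, `torusChar_sub_right`
(`TorusFourierProofs`); the Summits-side consumers `FunctionFieldCertificateAssembly.
sum_star_blockMulVec_dotProduct` (tent identity) and `WcbcsSsbToTorusLRO.stub_fejerClosure` (which
proves the same block Plancherel privately, in vector form). Mathlib: `ZMod.val_cast_of_lt`,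
`Complex.conj_mul'`, `Fintype.card_fun`.
-/

noncomputable section

namespace Literature.MathematicalPhysics.QuantumLattice

open Matrix Finset Literature.Probability.LatticeModels
open scoped ComplexOrder ComplexConjugate

variable {L : ℕ}

/-! ### The box kernel -/

/-- Offsets of the box `[0,R)²` are distinct points of the torus once `R ≤ L`. [folklore] -/
theorem boxOffset_injective (R : ℕ) (hRL : R ≤ L) :
    Function.Injective fun u : Fin 2 → Fin R => fun i => (((u i : ℕ) : ZMod L) : ZMod L) := by
  intro u u' h
  funext i
  have hi := congrFun h i
  simp only at hi
  apply Fin.ext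
  have hu : ((u i : ℕ) : ZMod L).val = (u i : ℕ) := ZMod.val_cast_of_lt ((u i).2.trans_le hRL)
  have hu' : ((u' i : ℕ) : ZMod L).val = (u' i : ℕ) := ZMod.val_cast_of_lt ((u' i).2.trans_le hRL)
  rw [← hu, ← hu', hi]

variable [NeZero L]

/-- **Plancherel for the box kernel**: with `F_R(m) = Σ_{u ∈ [0,R)²} χ_m(u)`,
`Σ_m conj F_R(m) · F_R(m) = L² · R²` for `R ≤ L` (orthogonality of characters; the `R²` offsets are
distinct torus points). Stein–Shakarchi, *Fourier Analysis*, Ch. 2. [folklore] -/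
theorem sum_conj_boxKernel_mul_boxKernel (R : ℕ) (hRL : R ≤ L) :
    ∑ m : TorusSite 2 L, conj (∑ u : Fin 2 → Fin R, torusChar m fun i => ((u i : ℕ) : ZMod L)) *
        (∑ u : Fin 2 → Fin R, torusChar m fun i => ((u i : ℕ) : ZMod L)) =
      (L : ℂ) ^ 2 * (R : ℂ) ^ 2 := by
  classical
  have hinj := boxOffset_injective (L := L) R hRL
  calc ∑ m : TorusSite 2 L, conj (∑ u : Fin 2 → Fin R, torusChar m fun i => ((u i : ℕ) : ZMod L)) *
        (∑ u : Fin 2 → Fin R, torusChar m fun i => ((u i : ℕ) : ZMod L))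
      = ∑ m : TorusSite 2 L, ∑ u : Fin 2 → Fin R, ∑ u' : Fin 2 → Fin R,
          torusChar m ((fun i => ((u' i : ℕ) : ZMod L)) - fun i => ((u i : ℕ) : ZMod L)) := by
        refine Finset.sum_congr rfl fun m _ => ?_
        rw [map_sum, Finset.sum_mul_sum]
        refine Finset.sum_congr rfl fun u _ => Finset.sum_congr rfl fun u' _ => ?_
        rw [torusChar_sub_right, mul_comm]
    _ = ∑ u : Fin 2 → Fin R, ∑ u' : Fin 2 → Fin R,
          if ((fun i => ((u' i : ℕ) : ZMod L)) - fun i => ((u i : ℕ) : ZMod L)) = 0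
            then (L : ℂ) ^ 2 else 0 := by
        rw [Finset.sum_comm]
        refine Finset.sum_congr rfl fun u _ => ?_
        rw [Finset.sum_comm]
        refine Finset.sum_congr rfl fun u' _ => ?_
        exact sum_torusChar_left _
    _ = ∑ u : Fin 2 → Fin R, ∑ u' : Fin 2 → Fin R, if u = u' then (L : ℂ) ^ 2 else 0 := by
        refine Finset.sum_congr rfl fun u _ => Finset.sum_congr rfl fun u' _ => ?_
        congr 1
        rw [sub_eq_zero]
        exact propext ⟨fun h => (hinj h).symm, fun h => by rw [h]⟩
    _ = (L : ℂ) ^ 2 * (R : ℂ) ^ 2 := by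
        simp only [Finset.sum_ite_eq, Finset.mem_univ, if_true, Finset.sum_const, Finset.card_univ,
          Fintype.card_fun, Fintype.card_fin, nsmul_eq_mul]
        push_cast
        ring

/-! ### Block Plancherel -/

variable (g : Site 2 → ℝ)

/-- **The Fourier mode of the block family is the box kernel times the pair mode**: for the box pair
operators `B_a = Σ_{u ∈ [0,R)²} P_{a+u}`, `Σ_a conj χ_m(a) • B_a = F_R(m) • Δ_g(m)`,
`F_R(m) = Σ_{u ∈ [0,R)²} χ_m(u)` (translate each offset: `Σ_a conj χ_m(a) P_{a+u} = χ_m(u) Δ_g(m)`).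
Kennedy–Lieb–Shastry, PRL 61 (1988) 2582. [folklore] -/
theorem fourierMode_block (R : ℕ) (m : TorusSite 2 L) :
    ∑ a : TorusSite 2 L, conj (torusChar m a) •
        (∑ u : Fin 2 → Fin R, localPair g L (a + fun i => ((u i : ℕ) : ZMod L))) =
      (∑ u : Fin 2 → Fin R, torusChar m fun i => ((u i : ℕ) : ZMod L)) • pairFieldAt g L m := by
  have hshift : ∀ v : TorusSite 2 L,
      ∑ a : TorusSite 2 L, conj (torusChar m a) • localPair g L (a + v) =
        torusChar m v • pairFieldAt g L m := by
    intro v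
    rw [pairFieldAt_eq_sum_torusChar, Finset.smul_sum,
      ← Equiv.sum_comp (Equiv.subRight v)]
    refine Finset.sum_congr rfl fun x _ => ?_
    rw [Equiv.subRight_apply, sub_add_cancel, smul_smul, torusChar_sub_right, map_mul,
      Complex.conj_conj, mul_comm]
  simp_rw [Finset.smul_sum]
  rw [Finset.sum_comm]
  simp_rw [hshift]
  rw [Finset.sum_smul]

/-- **Block Plancherel**: `L² • Σ_a B_aᴴ B_a = Σ_m (conj F_R(m) F_R(m)) • Δ_g(m)ᴴ Δ_g(m)` for the box
pair operators `B_a = Σ_{u ∈ [0,R)²} P_{a+u}` (operator Plancherel `sum_conjTranspose_mul_fourierMode`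
applied to the block family, whose Fourier modes are `F_R(m) • Δ_g(m)`). Blocks may wrap around the
torus; no condition on `R`. Kennedy–Lieb–Shastry, PRL 61 (1988) 2582 (Parseval sum rule).
[cite: KLS1988PRL, p. 2582] -/
theorem sum_conjTranspose_block_mul_block (R : ℕ) :
    ((L : ℂ) ^ 2) • ∑ a : TorusSite 2 L,
        (∑ u : Fin 2 → Fin R, localPair g L (a + fun i => ((u i : ℕ) : ZMod L)))ᴴ *
          (∑ u : Fin 2 → Fin R, localPair g L (a + fun i => ((u i : ℕ) : ZMod L))) =
      ∑ m : TorusSite 2 L,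
        (conj (∑ u : Fin 2 → Fin R, torusChar m fun i => ((u i : ℕ) : ZMod L)) *
            (∑ u : Fin 2 → Fin R, torusChar m fun i => ((u i : ℕ) : ZMod L))) •
          ((pairFieldAt g L m)ᴴ * pairFieldAt g L m) := by
  have h := sum_conjTranspose_mul_fourierMode
    (fun a : TorusSite 2 L => ∑ u : Fin 2 → Fin R, localPair g L (a + fun i => ((u i : ℕ) : ZMod L)))
  simp only [fourierMode_block] at h
  rw [← h]
  refine Finset.sum_congr rfl fun m _ => ?_
  rw [conjTranspose_smul, smul_mul_smul_comm, starRingEnd_apply]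

/-- **Block Plancherel against a weight**, scalar form: for ANY matrix `P` (a density matrix, a
rank-one projection, …), `L² · tr (P Σ_a B_aᴴ B_a) = Σ_m (conj F_R(m) F_R(m)) · tr (P Δ_g(m)ᴴ Δ_g(m))`.
[folklore] -/
theorem trace_mul_sum_block_eq (P : Matrix (Finset (Orb (FermionTorus 2 L)))
      (Finset (Orb (FermionTorus 2 L))) ℂ) (R : ℕ) :
    (L : ℂ) ^ 2 * (P * ∑ a : TorusSite 2 L,
        (∑ u : Fin 2 → Fin R, localPair g L (a + fun i => ((u i : ℕ) : ZMod L)))ᴴ *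
          (∑ u : Fin 2 → Fin R, localPair g L (a + fun i => ((u i : ℕ) : ZMod L)))).trace =
      ∑ m : TorusSite 2 L,
        (conj (∑ u : Fin 2 → Fin R, torusChar m fun i => ((u i : ℕ) : ZMod L)) *
            (∑ u : Fin 2 → Fin R, torusChar m fun i => ((u i : ℕ) : ZMod L))) *
          (P * ((pairFieldAt g L m)ᴴ * pairFieldAt g L m)).trace := by
  have h := congrArg (fun T => (P * T).trace) (sum_conjTranspose_block_mul_block (L := L) g R)
  rw [Matrix.mul_smul, trace_smul, smul_eq_mul] at h
  rw [h, Finset.mul_sum, trace_sum]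
  refine Finset.sum_congr rfl fun m _ => ?_
  rw [Matrix.mul_smul, trace_smul, smul_eq_mul]

/-! ### A flat pair structure factor carries no block pair order -/

/-- **Flat structure factor ⇒ no block pair order (trace form).** For ANY matrix `P`, any bound
`S` and `R ≤ L`: if `Re tr (P Δ_g(m)ᴴ Δ_g(m)) ≤ S` at EVERY momentum `m`, then
`Re tr (P Σ_a B_aᴴ B_a) ≤ S · R²` for the box pair operators `B_a = Σ_{u ∈ [0,R)²} P_{a+u}` (block
Plancherel, `|F_R(m)|² ≥ 0`, `Σ_m |F_R(m)|² = L² R²`). Kennedy–Lieb–Shastry, PRL 61 (1988) 2582;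
Stein–Shakarchi Ch. 2. [folklore] -/
theorem re_trace_mul_sum_block_le_of_forall_mode_le
    (P : Matrix (Finset (Orb (FermionTorus 2 L))) (Finset (Orb (FermionTorus 2 L))) ℂ) {S : ℝ}
    (hS : ∀ m : TorusSite 2 L, (P * ((pairFieldAt g L m)ᴴ * pairFieldAt g L m)).trace.re ≤ S)
    (R : ℕ) (hRL : R ≤ L) :
    (P * ∑ a : TorusSite 2 L,
        (∑ u : Fin 2 → Fin R, localPair g L (a + fun i => ((u i : ℕ) : ZMod L)))ᴴ *
          (∑ u : Fin 2 → Fin R, localPair g L (a + fun i => ((u i : ℕ) : ZMod L)))).trace.re ≤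
      S * (R : ℝ) ^ 2 := by
  classical
  set F : TorusSite 2 L → ℂ := fun m => ∑ u : Fin 2 → Fin R, torusChar m fun i => ((u i : ℕ) : ZMod L)
    with hF
  have hLr : (0 : ℝ) < (L : ℝ) ^ 2 := by
    have : (0 : ℝ) < L := Nat.cast_pos.2 (Nat.pos_of_ne_zero (NeZero.ne L))
    positivity
  have key := congrArg Complex.re (trace_mul_sum_block_eq (L := L) g P R)
  rw [show ((L : ℂ) ^ 2) = (((L : ℝ) ^ 2 : ℝ) : ℂ) by push_cast; rfl, Complex.re_ofReal_mul,
    Complex.re_sum] at key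
  have hterm : ∀ m : TorusSite 2 L,
      ((conj (F m) * F m) * (P * ((pairFieldAt g L m)ᴴ * pairFieldAt g L m)).trace).re ≤
        (conj (F m) * F m).re * S := by
    intro m
    rw [Complex.conj_mul', ← Complex.ofReal_pow, Complex.re_ofReal_mul, Complex.ofReal_re]
    exact mul_le_mul_of_nonneg_left (hS m) (sq_nonneg _)
  have hsumF : ∑ m : TorusSite 2 L, (conj (F m) * F m).re = (L : ℝ) ^ 2 * (R : ℝ) ^ 2 := by
    rw [← Complex.re_sum, sum_conj_boxKernel_mul_boxKernel R hRL]
    norm_cast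
  have hle : (L : ℝ) ^ 2 * (P * ∑ a : TorusSite 2 L,
      (∑ u : Fin 2 → Fin R, localPair g L (a + fun i => ((u i : ℕ) : ZMod L)))ᴴ *
        (∑ u : Fin 2 → Fin R, localPair g L (a + fun i => ((u i : ℕ) : ZMod L)))).trace.re ≤
      (L : ℝ) ^ 2 * (S * (R : ℝ) ^ 2) := by
    rw [key]
    calc _ ≤ ∑ m : TorusSite 2 L, (conj (F m) * F m).re * S := Finset.sum_le_sum fun m _ => hterm m
      _ = (L : ℝ) ^ 2 * (S * (R : ℝ) ^ 2) := by rw [← Finset.sum_mul, hsumF]; ring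
  exact le_of_mul_le_mul_left hle hLr

/-- **Flat structure factor ⇒ no block pair order (vector form).** For any Fock vector `ψ`, any
bound `S` and `R ≤ L`: if `‖Δ_g(m) ψ‖² ≤ S` at EVERY momentum `m` (i.e. the pair structure factor
`S_ψ(m) = ‖Δ_g(m)ψ‖²/L²` is `≤ S/L²` uniformly on the Brillouin zone), then the block pair coherence
obeys `Σ_a ‖B_a ψ‖² ≤ S · R²` (`dotProduct` form). With the tent identity `Σ_a ‖B_a ψ‖² = R² T_R(ψ)`:
the Fejér-box pair functional is `T_R(ψ) ≤ L² · sup_m S_ψ(m)` — a state with a bounded pair structure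
factor has mesoscopic pair-order margin `≤ sup_m S_ψ(m) / R²` at scale `R`.
Kennedy–Lieb–Shastry, PRL 61 (1988) 2582; Stein–Shakarchi Ch. 2. [folklore] -/
theorem re_sum_star_block_mulVec_le_of_forall_mode_le (ψ : Fock (Orb (FermionTorus 2 L))) {S : ℝ}
    (hS : ∀ m : TorusSite 2 L,
      (star (pairFieldAt g L m *ᵥ ψ) ⬝ᵥ (pairFieldAt g L m *ᵥ ψ)).re ≤ S)
    (R : ℕ) (hRL : R ≤ L) :
    (∑ a : TorusSite 2 L,
        star ((∑ u : Fin 2 → Fin R, localPair g L (a + fun i => ((u i : ℕ) : ZMod L))) *ᵥ ψ) ⬝ᵥ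
          ((∑ u : Fin 2 → Fin R, localPair g L (a + fun i => ((u i : ℕ) : ZMod L))) *ᵥ ψ)).re ≤
      S * (R : ℝ) ^ 2 := by
  classical
  -- the rank-one weight `P = ψ ψ†`: `tr (P A) = ⟨ψ, A ψ⟩`
  set P : Matrix (Finset (Orb (FermionTorus 2 L))) (Finset (Orb (FermionTorus 2 L))) ℂ :=
    vecMulVec ψ (star ψ) with hP
  have htr : ∀ A : Matrix (Finset (Orb (FermionTorus 2 L))) (Finset (Orb (FermionTorus 2 L))) ℂ,
      (P * A).trace = star ψ ⬝ᵥ A *ᵥ ψ := by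
    intro A
    rw [hP, vecMulVec_mul, trace_vecMulVec, dotProduct_comm, ← dotProduct_mulVec]
  have hS' : ∀ m : TorusSite 2 L, (P * ((pairFieldAt g L m)ᴴ * pairFieldAt g L m)).trace.re ≤ S := by
    intro m
    rw [htr, ← star_mulVec_dotProduct_mulVec]
    exact hS m
  have h := re_trace_mul_sum_block_le_of_forall_mode_le (L := L) g P hS' R hRL
  rw [htr, Matrix.sum_mulVec, dotProduct_sum, Complex.re_sum] at h
  rw [Complex.re_sum]
  convert h using 2 with a
  rw [star_mulVec_dotProduct_mulVec]

end Literature.MathematicalPhysics.QuantumLattice
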